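/-
Origin: expansion seat `planner-pub-hodgecm-model1-0`, handover #1 v3 2026-08-18T17:34:35Z md5 22dc4341e4fe (STATUS-only HANDOVER L4989/L5009; consumed by prl1-g11 #3 ThetaModelExistsPerLAxioms; packager row) (`HOME/pub-hodgecm-model1/lean/ThetaModelExists.lean`, md5 22dc4341, 390 lines);
landed by the packager successor (mc-unitary-1-g3, gen-8 kit) in gate run 32 as `HodgeCM/Model/ThetaModelExists.lean` (verbatim).
-/
/-
Copyright: pub-hodgecm formalisation cell (harness21, 2026). New file (not vendored).
Origin: HOME/pub-hodgecm-model1/lean/ThetaModelExists.lean — session planner-pub-hodgecm-model1-0 (unit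
pub-hodgecm-model1, SCOPING SEAT model1: MODEL-SCOPE PART A, top-down from the binder types).  Intended final
place: `HodgeCM/Model/ThetaModelExists.lean` (ONE NEW FILE, additive leaf; nothing imports it).
-/
import Summits.HodgeConjecture.HodgeCM.Automorphic.SignRecipeEndStateAllChars_2

set_option autoImplicit false

/-!
# The typed hypothesis "a theta model exists" — a RESTATEMENT of the instance problem, NOT a discharge

Deliverable (c) of the scoping seat model1 (`HOME/MODEL-SCOPE.md` PART A §A.5), PACKAGE-side form.  Referee
mc-ref1 ENTRY 2 ruling (STATUS 2026-08-18T17:21:10Z) is honoured verbatim: `Universe.ThetaModelExists` below is a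
legitimate RESTATEMENT of "the model exists" and constitutes ZERO progress toward the END STATE, which needs a
CLOSED TERM `C : U.AdelicThetaCore₀` with the inputs DISCHARGED on it; the conjunct-parts with no published source
(listed below) are kernel obligations on the constructed `C` or GAPS.md rows — never hypotheses of the end state.

## §1 What is stated

* `Universe.ThetaModelExists U` — the EXACT residual of the package's binder-minimal END STATE E2
  (`Assembly.perL_ofSignRecipe₇`, `Assembly.realisationExists_ofArchTypes`,
  `HodgeCM/Automorphic/SignRecipeEndStateAllChars.lean`): there are a convention bit `h`, a core datum
  `C : U.AdelicThetaCore₀ = (emb, cover, wm, Theta)` over the GENUINE adelic unitary groups (their quotients compact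
  by the in-package theorem `printFact_unitaryCompact_holds`), per context two archimedean side types
  `w12 c, w34 c : SideArchType`, such that the SEVEN all-characters inputs `AllCharsNonDesign` hold.  No `hP`, no
  Def 3.2 predicate `allowed`, no `chars`.  Consequences (one line each from the package): `RealisationExistsPerL ∧
  RealisationExistsFace`, `U.PerL`, and with the [QW8]-side inputs `U.HC_CM`.
* `Universe.ThetaModelExistsOn U S` — the same with the five OPEN inputs demanded ONLY at good contexts in a class
  `S` of seesaw contexts (`ThetaModel.AllCharsNonDesignOn`), and `Universe.ThetaModelExists_sextic U :=
  ThetaModelExistsOn (fun c => finrank ℚ c.K = 6)` — the RESTRICTED (sextic) hypothesis of MODEL-SCOPE (b).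
* KERNEL RESULT of this file (MODEL-SCOPE PART A §A.4 verdict 1 made checkable):
  `perL_of_thetaModelExists_sextic : U.ModelAxioms → U.Fact_hodgeRiemann20 → U.ThetaModelExists_sextic → U.PerL`
  — the sextic-restricted inputs SUFFICE for `W_per^L`, because the realisation is consumed only at the context
  `⟨K, t, φ₁, D⟩` built from PerL's own sextic data (`ThetaModel.nonempty_thetaRealisation_at`, the POINTWISE
  form of `HodgeCM.Proofs.RealisationConstruction.nonempty_thetaRealisation_ofD`: all six OPEN bodies at ONE good
  context).  NOT provable and not claimed: `ThetaModelExists_sextic → RealisationExistsFace` (the face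
  realisation of rfwf Thm 4.1 needs the inputs at `K = L = F` Galois CM of EVERY degree `≥ 6`,
  `HodgeCM.Universe.RealisationExistsFace`), hence no `HC_CM` from the sextic hypothesis (§A.4 verdict 2).

## §2 Conjunct → source table (ABSOLUTE RULE: PerL / QW8 / 2001-programme claims are NOT sources; they are the
conjuncts under adjudication)

| conjunct of `AllCharsNonDesign` (over the data `emb, cover, wm, Theta, w12, w34`) | published source, verbatim numbers | status |
|---|---|---|
| `embCover` (Matsushima embedding injective on `H^{2,0} ⊕ H^{0,2}`, level-compatible) | Borel–Wallach, *Continuous cohomology…* (2nd ed.) VII Thm 3.2 pp. 142–143, 3.5, Thm 3.6; Matsushima–Murakami, Ann. Math. 78 (1963) | PRINT once `emb` IS the Matsushima map of a compact ball quotient (object match = referee §0-B2) |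
| `innerEmb` (Petersson = `c·∫ η ∪ η̄′`) | same, + Hodge–Riemann: Voisin I Thm 6.32 (p. 128 l. 35) | PRINT, same proviso |
| `thetaSub` (theta one-forms of type `Ψ_i` are `B_{Ψ_i}`-isotypic `φ₁`-eigen: N12) | [Liu21] Yifeng Liu, *Fourier–Jacobi cycles and arithmetic relative trace formula*, Cambridge J. Math. 9 (2021) 1–147 = arXiv:2102.11518, Prop 4.13 / Thm 4.18 (2) / Cor 4.20 (numbering of the compiled arXiv version, as in `HodgeCM/Literature/{LiuCMData, AlbaneseUnitaryShimura}.lean`); Shimura, *Abelian varieties with CM* (1998) §6.2 Thm 3, §8 Thm 3 | the DICTIONARY "automorphic type Ψ ↔ B_Ψ-isotypic" is PerL Prop 2.2/2.3: **NO PUBLISHED SOURCE** as parametrised (BINDER-TRIAGE row hAlb, Γ-free but internal) |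
| `thetaWedge` (Prop 4.3: nonzero wedge of theta one-forms of types `Ψ₀, Ψ₁`: N33) | group-theoretic core: Sansuc, Crelle 327 (1981) Cor 3.5(iii); Platonov–Rapinchuk Thm 7.7; Venkataramana, Compositio 125 (2001) Thm 8; SUPPLY: Rallis inner product [Gan–Qiu–Takeda, arXiv:1207.4709 §11.3], [Li, Crelle 428 (1992) Thm 2.1], [Harris–Kudla–Sweet, JAMS 9 (1996) (1.14)–(1.15)] | the assembled statement is PerL's own: **NO PUBLISHED SOURCE**; machine-checked reductions `HodgeCM.Automorphic.{ThetaWedgeSplit, HeckeWedge}` |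
| `thetaGen12All` (Lemma 3.5, seesaw direction, target `S₁₂^all`: N19w) | Kudla, Israel J. Math. 87 (1994) §§1, 3 (splitting `ω_W|_{G×T} = ω_{W₁} ⊠ ω_{W₂}`); Harris–Kudla–Sweet, JAMS 9 (1996) §§1–3, (1.12)–(1.19) p. 952 (print-as-definition), Cor A.3 p. 998; Rao, Pacific J. Math. 157 (1993) Prop 3.7 p. 357 | multiplicativity Γ2a is KERNEL modulo these verbatim prints since gate run 24 (`HodgeCM.Automorphic.SeesawSplittingDescent`: `HKSDescent.jt_compat`; BINDER-TRIAGE §6.3(a)/§7); the seesaw identity as assembled for THIS pair is PerL's: **NO SINGLE PUBLISHED SOURCE** |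
| `thetaReal34All` (Lemma 3.5, generation direction, for EVERY character of type `w′`: N19g) | same + Kashiwara–Vergne, Invent. Math. 44 (1978); Adams, *The theta correspondence over ℝ* (2007) 6.3/6.6; **[Ich22] A. Ichino, *Theta lifting for tempered representations of real unitary groups*, Adv. Math. 398 (2022) 108188 = arXiv:2008.06174, §4.1 (splitting characters `χ_V = (z/√(zz̄))^{m₀}`, `χ_W = (…)^{n₀}`, `ψ = e^{−2π√−1x}`) + Lemma 7.10 (Fock-model `K × K′`-type correspondence with the shifts `(r−s)/2 + m₀/2`, `(p−q)/2 + n₀/2`) + Thm 4.1(1)** (verified verbatim, BINDER-TRIAGE §6.3(b)/§7) | the archimedean weight dictionary Γ1a/Γ1c is PRINT [Ich22] + finite bookkeeping in the signatures `(1,0;2,1),(2,0;2,1),(1,0;3,0),(2,0;3,0)`; **NO PUBLISHED SOURCE** only for the definition-level object match D5-arch (this model's archimedean `ω` with PerL's `ψ` and κ-dependent splitting characters = Ichino's `ω_{V,W,χ_V,χ_W,ψ}` with named `(m₀,n₀)`) |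
| `occ` (Lemma 4.1(c): the type `w`/`w′` occurs: N29) | Kashiwara–Vergne (1978); Adams (2007); Getz–Hahn (2024) L4.2.2 / P4.2.3 (compact places); [Ich22] §4.1 + Lemma 7.10 as above | the identification `κ_b`-part = predicted `K_∞`-type (Lemma 4.1(b), Γ1b) is torus-weight bookkeeping over [Ich22] L7.10; **NO PUBLISHED SOURCE** only for the same D5-arch object match |

and the DEFINITIONAL wiring identities inside the data (`Λ_wedge`, `ϑ_period`, `wedge_mem`, `Dict_thetaClass₀/₁`,
Weil 1964 n°37/41 shape of `wm`) — true by construction of `(emb, wm, Theta)` and by nothing citable.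
-/

noncomputable section

open scoped TensorProduct InnerProductSpace
open NumberField

namespace HodgeCM

open Literature.AlgebraicGeometry.Motives (CMType)
open HodgeCM.Prior.Perl34File HodgeCM.Prior.Perl34File.Perl34

namespace Universe

namespace ThetaModel

variable {U : Universe} (T : U.ThetaModel)

/-! ## §3 The six OPEN input bodies AT ONE context (verbatim bodies of `ThetaFacts.Open_*`,
`SignRecipeEndStateAllChars.Open_*All`) -/

section At

variable {L : CMField} {ι₁ : L →+* ℂ} (V : HermSpace3 L ι₁) (c : SeesawCtx L)

/-- Body of `Open_thetaSub` (N12) at the context `c`. -/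
def ThetaSubAt : Prop := ∀ (i : Fin 4) (Γ : Level V), T.Theta V c i Γ ⊆ U.Uiso Γ c.K (c.Ψ i) c.σ

/-- Body of `Open_thetaWedge` (N33, Prop 4.3) at `(V, c)`. -/
def ThetaWedgeAt : Prop :=
  ∃ Γ : Level V, ∃ ω₁ ∈ T.Theta V c 0 Γ, ∃ ω₂ ∈ T.Theta V c 1 Γ, U.cup2C (U.pms L ι₁ V Γ) 1 ω₁ ω₂ ≠ 0

/-- Body of `Open_thetaGen12` (N19w, target `S₁₂`) at `(V, c)`. -/
def ThetaGen12At : Prop :=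
  ∀ (Γ : Level V) (ω₁ ω₂ : U.CohC (U.pms L ι₁ V Γ) 1), ω₁ ∈ T.Theta V c 0 Γ → ω₂ ∈ T.Theta V c 1 Γ →
    T.Λ Γ ω₁ ω₂ ∈ (T.t12 V c).S12

/-- Body of `Open_thetaGen12All` (N19w, target `S₁₂^all`) at `(V, c)`. -/
def ThetaGen12AllAt : Prop :=
  ∀ (Γ : Level V) (ω₁ ω₂ : U.CohC (U.pms L ι₁ V Γ) 1), ω₁ ∈ T.Theta V c 0 Γ → ω₂ ∈ T.Theta V c 1 Γ →
    T.Λ Γ ω₁ ω₂ ∈ (Submodule.span ℂ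
      {u : T.HG L ι₁ V | ∃ (χ : (T.t12 V c).X) (Φ : T.SK V c), u = (T.t12 V c).ϑ χ Φ}).topologicalClosure

/-- Body of `Open_thetaReal34` (N19g, allowed characters) at `(V, c)`. -/
def ThetaReal34At : Prop :=
  ∀ χ : (T.t34 V c).X, (T.t34 V c).allowed χ → ∀ Φ : T.SK V c,
    (T.t34 V c).ϑ χ Φ ∈ (Submodule.span ℂ (T.wedgeSet V c 2 3)).topologicalClosure

/-- Body of `Open_thetaReal34All` (N19g, EVERY character of type `w′`) at `(V, c)`. -/
def ThetaReal34AllAt : Prop :=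
  ∀ (χ : (T.t34 V c).X) (Φ : T.SK V c),
    (T.t34 V c).ϑ χ Φ ∈ (Submodule.span ℂ (T.wedgeSet V c 2 3)).topologicalClosure

/-- Body of `Open_chars` (N31) at `(V, c)`. -/
def CharsAt : Prop :=
  (∀ χ : (T.t12 V c).X, (T.t12 V c).allowed χ) ∧ (∀ χ : (T.t34 V c).X, (T.t34 V c).allowed χ)

/-- Body of `Open_occ` (N29) at `(V, c)`. -/
def OccAt : Prop :=
  (∀ (Φ : T.SK V c) (i : T.SigIdx V c),
    (∃ v ∈ (T.core V c).hatσ i, (T.core V c).TΦ Φ v ≠ 0) → (T.t12 V c).wOccurs i) ∧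
  (∀ (Φ : T.SK V c) (i : T.SigIdx V c),
    (∃ v ∈ (T.core V c).hatσ i, (T.core V c).TΦ Φ v ≠ 0) → (T.t34 V c).wOccurs i)

end At

/-! The global inputs ARE these bodies at every good context (definitional bookkeeping, `Iff.rfl`). -/

/-- (Ported verbatim from the HodgeCMPerL package; no docstring in the source.) -/
theorem open_thetaSub_iff : T.Open_thetaSub ↔
    ∀ {L : CMField} {ι₁ : L →+* ℂ} (V : HermSpace3 L ι₁) (c : SeesawCtx L), T.GoodCtx ι₁ c → T.ThetaSubAt V c :=
  Iff.rfl

/-- (Ported verbatim from the HodgeCMPerL package; no docstring in the source.) -/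
theorem open_thetaWedge_iff : T.Open_thetaWedge ↔
    ∀ {L : CMField} {ι₁ : L →+* ℂ} (V : HermSpace3 L ι₁) (c : SeesawCtx L), T.GoodCtx ι₁ c → T.ThetaWedgeAt V c :=
  Iff.rfl

/-- (Ported verbatim from the HodgeCMPerL package; no docstring in the source.) -/
theorem open_thetaGen12_iff : T.Open_thetaGen12 ↔
    ∀ {L : CMField} {ι₁ : L →+* ℂ} (V : HermSpace3 L ι₁) (c : SeesawCtx L), T.GoodCtx ι₁ c → T.ThetaGen12At V c :=
  Iff.rfl

/-- (Ported verbatim from the HodgeCMPerL package; no docstring in the source.) -/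
theorem open_thetaGen12All_iff : T.Open_thetaGen12All ↔
    ∀ {L : CMField} {ι₁ : L →+* ℂ} (V : HermSpace3 L ι₁) (c : SeesawCtx L), T.GoodCtx ι₁ c →
      T.ThetaGen12AllAt V c :=
  Iff.rfl

/-- (Ported verbatim from the HodgeCMPerL package; no docstring in the source.) -/
theorem open_thetaReal34_iff : T.Open_thetaReal34 ↔
    ∀ {L : CMField} {ι₁ : L →+* ℂ} (V : HermSpace3 L ι₁) (c : SeesawCtx L), T.GoodCtx ι₁ c →
      T.ThetaReal34At V c :=
  Iff.rfl

/-- (Ported verbatim from the HodgeCMPerL package; no docstring in the source.) -/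
theorem open_thetaReal34All_iff : T.Open_thetaReal34All ↔
    ∀ {L : CMField} {ι₁ : L →+* ℂ} (V : HermSpace3 L ι₁) (c : SeesawCtx L), T.GoodCtx ι₁ c →
      T.ThetaReal34AllAt V c :=
  Iff.rfl

/-- (Ported verbatim from the HodgeCMPerL package; no docstring in the source.) -/
theorem open_chars_iff : T.Open_chars ↔
    ∀ {L : CMField} {ι₁ : L →+* ℂ} (V : HermSpace3 L ι₁) (c : SeesawCtx L), T.GoodCtx ι₁ c → T.CharsAt V c :=
  Iff.rfl

/-- (Ported verbatim from the HodgeCMPerL package; no docstring in the source.) -/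
theorem open_occ_iff : T.Open_occ ↔
    ∀ {L : CMField} {ι₁ : L →+* ℂ} (V : HermSpace3 L ι₁) (c : SeesawCtx L), T.GoodCtx ι₁ c → T.OccAt V c :=
  Iff.rfl

/-! ## §4 The construction of the theta realisation, POINTWISE

`HodgeCM.Proofs.RealisationConstruction.nonempty_thetaRealisation_ofD` (proof body verbatim) with every OPEN
input demanded only AT the given good context `(V, c)`: the realisation of PerL Def 3.2 – §4 at `c` reads the model's
inputs nowhere else.  This is what makes context-restricted input records (§5) sufficient for `W_per^L`. -/

/-- **The theta realisation at ONE context** from the two PRINT facts, `Fact_hodgeRiemann20`, and the six OPEN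
input bodies AT that context — `GoodCtx` itself is NOT needed by the construction (it only gates the inputs). -/
theorem nonempty_thetaRealisation_at (M : U.ModelAxioms) (h₁ : T.Fact_embCover) (h₂ : T.Fact_innerEmb)
    (hHR : U.Fact_hodgeRiemann20) {L : CMField} {ι₁ : L →+* ℂ} (V : HermSpace3 L ι₁) (c : SeesawCtx L)
    (h₅ : T.ThetaSubAt V c) (h₆ : T.ThetaWedgeAt V c) (h₇ : T.ThetaGen12At V c)
    (h₈ : T.ThetaReal34At V c) (h₉ : T.CharsAt V c) (h₁₀ : T.OccAt V c) :
    Nonempty (U.ThetaRealisation ι₁ V c.K c.Ψ c.σ) := by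
  have hH10 : ∀ (i : Fin 4) (Γ : Level V), ∀ ω ∈ T.Theta V c i Γ, ω ∈ U.H10 (U.pms L ι₁ V Γ) :=
    fun i Γ ω hω => U.Uiso_le_H10 M.pull_hodge Γ c.K (c.Ψ i) c.σ (h₅ i Γ hω)
  refine ⟨{
    H := T.H V c
    HG := T.HG L ι₁ V
    CG := T.CG V c
    G := T.G V c
    SK := T.SK V c
    SigIdx := T.SigIdx V c
    SigIdxG := T.SigIdxG V c
    S := { core := T.core V c, t12 := T.t12 V c, t34 := T.t34 V c
           H_chars12 := h₉.1, H_chars34 := h₉.2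
           H_occ12 := h₁₀.1, H_occ34 := h₁₀.2 }
    Λ := fun Γ => T.Λ Γ
    Theta := fun i Γ => T.Theta V c i Γ
    Theta_sub := fun i Γ => h₅ i Γ
    lineField := ?_
    gen12 := fun Γ ω₁ ω₂ e₁ e₂ => h₇ Γ ω₁ ω₂ e₁ e₂
    real34 := fun χ hχ Φ => h₈ χ hχ Φ
    cover := fun Γ Γ' h => T.cover Γ Γ' h
    Λ_cover := ?_
    level_inf := levelDirected L ι₁ V
    inner_Λ := ?_ }⟩
  · -- Prop 4.3 on forms ⇒ on L² functions (Hodge–Riemann)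
    obtain ⟨Γ, ω₁, e₁, ω₂, e₂, hne⟩ := h₆
    exact ⟨Γ, ω₁, e₁, ω₂, e₂,
      T.emb_ne_zero M h₂ hHR Γ (cup2C_mem_F2 M _ (hH10 0 Γ ω₁ e₁) (hH10 1 Γ ω₂ e₂)) hne⟩
  · -- level independence of the wedge-function
    intro Γ Γ' h ω ω'
    show T.emb Γ' (U.cup2C _ 1 (U.pullC (T.cover Γ Γ' h) 1 ω) (U.pullC (T.cover Γ Γ' h) 1 ω')) =
      T.emb Γ (U.cup2C _ 1 ω ω')
    rw [← pullC_cup2C M.pull_cup]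
    exact h₁ Γ Γ' h _
  · -- Petersson = period
    intro Γ
    obtain ⟨c₀, hc₀, h⟩ := h₂ Γ
    refine ⟨c₀, hc₀, fun ω hω => ?_⟩
    show ⟪T.emb Γ (U.cup2C _ 1 (ω 2) (ω 3)), T.emb Γ (U.cup2C _ 1 (ω 0) (ω 1))⟫_ℂ = c₀ * U.period _ ω
    rw [h _ _ (cup2C_mem_F2 M _ (hω 0) (hω 1)) (cup2C_mem_F2 M _ (hω 2) (hω 3)), conj_cup2C _ 1]
    rfl

/-- **Pointwise construction, all-characters form**: if every character is allowed AT `c` (`CharsAt`), the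
`S₁₂^all`-target body and the every-character reality body suffice (`S₁₂ = S₁₂^all` at `c`,
`TorusData.S12_eq_allChars`). -/
theorem nonempty_thetaRealisation_at_allChars (M : U.ModelAxioms) (h₁ : T.Fact_embCover)
    (h₂ : T.Fact_innerEmb) (hHR : U.Fact_hodgeRiemann20) {L : CMField} {ι₁ : L →+* ℂ} (V : HermSpace3 L ι₁)
    (c : SeesawCtx L) (h₅ : T.ThetaSubAt V c) (h₆ : T.ThetaWedgeAt V c)
    (h₇ : T.ThetaGen12AllAt V c) (h₈ : T.ThetaReal34AllAt V c) (h₉ : T.CharsAt V c) (h₁₀ : T.OccAt V c) :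
    Nonempty (U.ThetaRealisation ι₁ V c.K c.Ψ c.σ) :=
  T.nonempty_thetaRealisation_at M h₁ h₂ hHR V c h₅ h₆
    (fun Γ ω₁ ω₂ e₁ e₂ => by
      rw [(T.t12 V c).S12_eq_allChars h₉.1, TorusData.allChars_S12]
      exact h₇ Γ ω₁ ω₂ e₁ e₂)
    (fun χ _ Φ => h₈ χ Φ) h₉ h₁₀

/-! ## §5 Inputs restricted to a class of contexts -/

/-- **The seven all-characters inputs, the five OPEN ones demanded only at good contexts in the class `S`.**
`embCover`, `innerEmb` (PRINT) are kept unrestricted (they carry no context; MODEL-SCOPE A.3 corner (R1)). -/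
structure AllCharsNonDesignOn (S : ∀ {L : CMField}, SeesawCtx L → Prop) : Prop where
  embCover : T.Fact_embCover
  innerEmb : T.Fact_innerEmb
  thetaSub : ∀ {L : CMField} {ι₁ : L →+* ℂ} (V : HermSpace3 L ι₁) (c : SeesawCtx L), T.GoodCtx ι₁ c → S c →
    T.ThetaSubAt V c
  thetaWedge : ∀ {L : CMField} {ι₁ : L →+* ℂ} (V : HermSpace3 L ι₁) (c : SeesawCtx L), T.GoodCtx ι₁ c → S c →
    T.ThetaWedgeAt V c
  thetaGen12All : ∀ {L : CMField} {ι₁ : L →+* ℂ} (V : HermSpace3 L ι₁) (c : SeesawCtx L), T.GoodCtx ι₁ c →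
    S c → T.ThetaGen12AllAt V c
  thetaReal34All : ∀ {L : CMField} {ι₁ : L →+* ℂ} (V : HermSpace3 L ι₁) (c : SeesawCtx L), T.GoodCtx ι₁ c →
    S c → T.ThetaReal34AllAt V c
  occ : ∀ {L : CMField} {ι₁ : L →+* ℂ} (V : HermSpace3 L ι₁) (c : SeesawCtx L), T.GoodCtx ι₁ c → S c →
    T.OccAt V c

/-- Restriction: the unrestricted seven inputs give the `S`-restricted ones for every `S`. -/
theorem AllCharsNonDesign.on {T : U.ThetaModel} (A : T.AllCharsNonDesign)
    (S : ∀ {L : CMField}, SeesawCtx L → Prop) : T.AllCharsNonDesignOn S :=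
  ⟨A.embCover, A.innerEmb, fun V c hc _ => A.thetaSub V c hc, fun V c hc _ => A.thetaWedge V c hc,
    fun V c hc _ => A.thetaGen12All V c hc, fun V c hc _ => A.thetaReal34All V c hc,
    fun V c hc _ => A.occ V c hc⟩

/-- With the trivial class the restricted record IS the unrestricted one. -/
theorem allCharsNonDesignOn_univ_iff :
    T.AllCharsNonDesignOn (fun _ => True) ↔ T.AllCharsNonDesign :=
  ⟨fun A => ⟨A.embCover, A.innerEmb, fun V c hc => A.thetaSub V c hc trivial,
      fun V c hc => A.thetaWedge V c hc trivial, fun V c hc => A.thetaGen12All V c hc trivial,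
      fun V c hc => A.thetaReal34All V c hc trivial, fun V c hc => A.occ V c hc trivial⟩,
    fun A => A.on _⟩

/-- Monotonicity in the class. -/
theorem AllCharsNonDesignOn.mono {T : U.ThetaModel} {S S' : ∀ {L : CMField}, SeesawCtx L → Prop}
    (A : T.AllCharsNonDesignOn S) (hSS' : ∀ {L : CMField} (c : SeesawCtx L), S' c → S c) :
    T.AllCharsNonDesignOn S' :=
  ⟨A.embCover, A.innerEmb, fun V c hc h => A.thetaSub V c hc (hSS' c h),
    fun V c hc h => A.thetaWedge V c hc (hSS' c h), fun V c hc h => A.thetaGen12All V c hc (hSS' c h),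
    fun V c hc h => A.thetaReal34All V c hc (hSS' c h), fun V c hc h => A.occ V c hc (hSS' c h)⟩

/-- **`RealisationExistsPerL` from inputs restricted to any class containing the SEXTIC contexts** (+ `M`,
`Open_chars` at those contexts, the two design constraints, Hodge–Riemann): PerL's realisation is built at the
context `⟨K, t, φ₁, D⟩` with `K` the given sextic field and `D` the CONSTRUCTED forced-sign seesaw datum
(`exists_seesawDatum_constructed`, no local–global input). -/
theorem realisationExistsPerL_of_on (M : U.ModelAxioms) {S : ∀ {L : CMField}, SeesawCtx L → Prop}
    (hS : ∀ {L : CMField} (c : SeesawCtx L), Module.finrank ℚ c.K = 6 → S c)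
    (A : T.AllCharsNonDesignOn S)
    (hch : ∀ {L : CMField} {ι₁ : L →+* ℂ} (V : HermSpace3 L ι₁) (c : SeesawCtx L), T.GoodCtx ι₁ c → S c →
      T.CharsAt V c)
    (hκ : T.Design_kappaConj) (hs : T.Design_frameSignConj) (hHR : U.Fact_hodgeRiemann20) :
    U.RealisationExistsPerL := by
  intro K L j _ hK _ φ hφ ι₁ hι₁ t ht V
  have hmem : ∀ i, φ 0 ∈ (t i).1 := fun i => (ht i 0).mpr (by fin_cases i <;> rfl)
  have hΨ : PairSum t := StubTree.pairSum_of_isPerLTypes K φ hφ hK t ht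
  obtain ⟨D, hD⟩ := T.exists_seesawDatum_constructed hκ hs j ι₁ t hΨ
  let c : SeesawCtx L := ⟨K, t, φ 0, D⟩
  have hc : T.GoodCtx ι₁ c := ⟨hΨ, StubTree.injective_of_isPerLTypes K φ hφ t ht, hmem, ⟨j, hι₁, hD⟩⟩
  have hSc : S c := hS c hK
  exact T.nonempty_thetaRealisation_at_allChars M A.embCover A.innerEmb hHR V c (A.thetaSub V c hc hSc)
    (A.thetaWedge V c hc hSc) (A.thetaGen12All V c hc hSc) (A.thetaReal34All V c hc hSc) (hch V c hc hSc)
    (A.occ V c hc hSc)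

end ThetaModel

/-! ## §6 The typed hypotheses -/

variable (U : Universe)

/-- **"A theta model exists"** — the exact residual of the binder-minimal END STATE E2: a convention bit, a core
datum `C = (emb, cover, wm, Theta)` over the genuine adelic unitary groups, per context the archimedean types of the
two torus sides, and the SEVEN all-characters inputs.  A RESTATEMENT of the instance problem (referee mc-ref1
ENTRY 2), not a discharge; conjunct → source table in the module docstring. -/
def ThetaModelExists : Prop :=
  ∃ (h : Bool) (C : U.AdelicThetaCore₀) (w12 w34 : ∀ {L : CMField}, SeesawCtx L → SideArchType L),
    (C.thetaModelArch h w12 w34).AllCharsNonDesign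

/-- **The same with the OPEN inputs demanded only at good contexts in the class `S`.** -/
def ThetaModelExistsOn (S : ∀ {L : CMField}, SeesawCtx L → Prop) : Prop :=
  ∃ (h : Bool) (C : U.AdelicThetaCore₀) (w12 w34 : ∀ {L : CMField}, SeesawCtx L → SideArchType L),
    (C.thetaModelArch h w12 w34).AllCharsNonDesignOn S

/-- **The RESTRICTED (sextic) typed hypothesis** of MODEL-SCOPE (b)/(c): the five OPEN inputs only at good
contexts whose type field `c.K` is SEXTIC — the contexts `⟨K, t, φ₁, D⟩` PerL actually builds (`K` sextic CM, `L`
its normal closure of degree 24 or 48, `V` any hermitian 3-space of signature (2,1) at `ι₁`, definite elsewhere).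
Sufficient for `W_per^L` (`perL_of_thetaModelExists_sextic`); NOT sufficient for the face realisation / `HC_CM`. -/
def ThetaModelExists_sextic : Prop :=
  U.ThetaModelExistsOn (fun c => Module.finrank ℚ c.K = 6)

variable {U}

/-- (Ported verbatim from the HodgeCMPerL package; no docstring in the source.) -/
theorem ThetaModelExists.on (H : U.ThetaModelExists) (S : ∀ {L : CMField}, SeesawCtx L → Prop) :
    U.ThetaModelExistsOn S := by
  obtain ⟨h, C, w12, w34, A⟩ := H
  exact ⟨h, C, w12, w34, A.on S⟩

/-- (Ported verbatim from the HodgeCMPerL package; no docstring in the source.) -/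
theorem thetaModelExists_iff_on_univ : U.ThetaModelExists ↔ U.ThetaModelExistsOn (fun _ => True) := by
  constructor
  · exact fun H => H.on _
  · rintro ⟨h, C, w12, w34, A⟩
    exact ⟨h, C, w12, w34, ((C.thetaModelArch h w12 w34).allCharsNonDesignOn_univ_iff).mp A⟩

/-- (Ported verbatim from the HodgeCMPerL package; no docstring in the source.) -/
theorem ThetaModelExists.sextic (H : U.ThetaModelExists) : U.ThetaModelExists_sextic := H.on _

/-- The END STATE of record E1 (eight inputs over side data with Def 3.2 predicates) gives the hypothesis
(monotonicity `allCharsNonDesign_arch_of_nonDesign` + `NonDesignInputs.allChars`). -/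
theorem thetaModelExists_of_nonDesignInputs (h : Bool) (C : U.AdelicThetaCore₀)
    (d12 d34 : ∀ {L : CMField}, SeesawCtx L → SideData L) (A : (C.thetaModel h d12 d34).NonDesignInputs) :
    U.ThetaModelExists :=
  ⟨h, C, fun c => (d12 c).arch, fun c => (d34 c).arch,
    ((C.thetaModelArch_nonDesignInputs_iff h _ _).mp (Assembly.allCharsNonDesign_arch_of_nonDesign U h C d12 d34 A))⟩

variable (U)

/-! ## §7 Consequences -/

/-- Both realisation inputs from the hypothesis (`Assembly.realisationExists_ofArchTypes`). -/
theorem realisationExists_of_thetaModelExists (M : U.ModelAxioms) (hHR : U.Fact_hodgeRiemann20)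
    (H : U.ThetaModelExists) : U.RealisationExistsPerL ∧ U.RealisationExistsFace := by
  obtain ⟨h, C, w12, w34, A⟩ := H
  exact Assembly.realisationExists_ofArchTypes U M h C w12 w34 A hHR

/-- **`W_per^L` from the hypothesis** (`Assembly.perL_ofSignRecipe₇`). -/
theorem perL_of_thetaModelExists (M : U.ModelAxioms) (hHR : U.Fact_hodgeRiemann20)
    (H : U.ThetaModelExists) : U.PerL := by
  obtain ⟨h, C, w12, w34, A⟩ := H
  exact Assembly.perL_ofSignRecipe₇ U M h C (fun c => (w12 c).side) (fun c => (w34 c).side) A hHR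

/-- **`HC_CM` from the hypothesis** and the [QW8]-side inputs (`Assembly.COR_CM_endState_ofSignRecipe₇`). -/
theorem hcCM_of_thetaModelExists (M : U.ModelAxioms) (h29 : U.Fact_weightSpan) (h30 : U.Fact_weightHodge)
    (hE : U.Qw8ExtProd) (hD : U.Qw8DualPushPull) (hMi : U.Qw8Milne) (hHR : U.Fact_hodgeRiemann20)
    (H : U.ThetaModelExists) : U.HC_CM := by
  obtain ⟨h, C, w12, w34, A⟩ := H
  exact Assembly.COR_CM_endState_ofSignRecipe₇ U M h29 h30 hE hD hMi h C (fun c => (w12 c).side)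
    (fun c => (w34 c).side) A hHR

/-- **`RealisationExistsPerL` from the SEXTIC-restricted hypothesis** — KERNEL form of MODEL-SCOPE PART A §A.4
verdict 1: for `W_per^L` the inputs are consumed only at sextic contexts. -/
theorem realisationExistsPerL_of_thetaModelExists_sextic (M : U.ModelAxioms) (hHR : U.Fact_hodgeRiemann20)
    (H : U.ThetaModelExists_sextic) : U.RealisationExistsPerL := by
  obtain ⟨h, C, w12, w34, A⟩ := H
  exact (C.thetaModelArch h w12 w34).realisationExistsPerL_of_on M (fun _ hK => hK) A
    (fun V c hc _ => C.thetaModelArch_chars h w12 w34 V c hc)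
    (C.design_kappaConj h _ _) (C.design_frameSignConj h _ _) hHR

/-- **`W_per^L` from the SEXTIC-restricted hypothesis.** -/
theorem perL_of_thetaModelExists_sextic (M : U.ModelAxioms) (hHR : U.Fact_hodgeRiemann20)
    (H : U.ThetaModelExists_sextic) : U.PerL :=
  Assembly.perL U M (U.realisationExistsPerL_of_thetaModelExists_sextic M hHR H)

/-- More generally: `W_per^L` from the hypothesis restricted to ANY class containing the sextic contexts. -/
theorem perL_of_thetaModelExistsOn (M : U.ModelAxioms) (hHR : U.Fact_hodgeRiemann20)
    {S : ∀ {L : CMField}, SeesawCtx L → Prop}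
    (hS : ∀ {L : CMField} (c : SeesawCtx L), Module.finrank ℚ c.K = 6 → S c) (H : U.ThetaModelExistsOn S) :
    U.PerL := by
  obtain ⟨h, C, w12, w34, A⟩ := H
  exact U.perL_of_thetaModelExists_sextic M hHR ⟨h, C, w12, w34, A.mono fun c hK => hS c hK⟩

end Universe

end HodgeCM

end
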